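import Summits.Ventures.WeilGRH.UniformConductorFloorPrincipalLog10
import Summits.Ventures.WeilGRH.UniformConductorFloorPrincipalMod167Log10
import Summits.Ventures.WeilGRH.UniformConductorFloorPrincipalMod173Log10
import HarnessLib

/-!
# GRH arm (rh-explicit, venture WeilGRH): PRIME MODULI at the window `(log 10)/2` — the exact dichotomy `p ≥ 173` (rung four)

Cell `rh-explicit`, WEIL TRACK — GRH ARM (weil-grh-1, gen9).  Assembly: `UniformConductorFloorPrincipalLog10.lean` (flat window: every prime `p ≤ 163` fails; uniform
floor: every `q ≥ 176`), the table-based Galerkin witness `…PrincipalMod167Log10.lean` (`167` FAILS) and the door cell `…PrincipalMod173Log10.lean` (`χ₀` mod `173`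
positive, margins `0.0136 ∣ 2.17`) with gen8's domination theorem.  **THEOREM (`forall_weilPositivityOnChar_log10half_iff_of_prime_complete`).**  For a PRIME `p`: every
Dirichlet character mod `p` is Weil-positive on `[−(log 10)/2, (log 10)/2]` iff `p ≥ 173`.  THE RUNG TABLE of the prime threshold `p*(t)`: `t = 1 → 79` (gen8),
`(log 8)/2 → 97`, `log 3 → 127`, `(log 10)/2 → 173` (gen9) — at this rung, for the first time, the largest failing prime (`167`) is NOT refuted by the flat window
(`164.59`) but by a 32-mode vector.  RH/GRH-free; standard axioms.

## References

* A. Weil (1952), (11) pp. 261–262 and the «lemme» p. 262 [Weil1952FormulesExplicites]; H. Yoshida (1992) §§5–7 [Yoshida1992HermitianForms].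
-/

noncomputable section

namespace Summit.Ventures.WeilGRH

open Literature.NumberTheory.LFunctions

namespace UniformFloor

variable {q : ℕ}

/-- ★★ `U_{(log 10)/2}(173)`: every Dirichlet character mod `173` is Weil-positive on `[−(log 10)/2, (log 10)/2]`. [cite: Weil1952FormulesExplicites, (11) pp. 261–262] -/
theorem forall_weilPositivityOnChar_log10half_mod_oneSeventyThree (χ : DirichletCharacter ℂ 173) : WeilPositivityOnChar χ (Real.log 10 / 2) := by
  have ha : (0 : ℝ) < Real.log 10 / 2 := by
    have : (1 : ℝ) < 10 := by norm_num
    positivity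
  exact WeilPositivityOnChar.of_principal (by norm_num) ha PrincipalMod173Log10.weilPositivityOnChar_log10half_principal_mod_oneSeventyThree χ

/-- ★★★ **PRIME MODULI at `(log 10)/2`: the exact dichotomy `p ≥ 173`.** [cite: Weil1952FormulesExplicites, (11) pp. 261–262 and the «lemme» p. 262] -/
theorem forall_weilPositivityOnChar_log10half_iff_of_prime_complete (hp : q.Prime) :
    (∀ χ : DirichletCharacter ℂ q, WeilPositivityOnChar χ (Real.log 10 / 2)) ↔ 173 ≤ q := by
  constructor
  · intro h
    by_contra hlt
    by_cases h167 : q = 167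
    · subst h167
      exact not_weilPositivityOnChar_log10half_principal_mod_167 (h 1)
    · have h163 : q ≤ 163 := by
        by_contra h'
        have h164 : 164 ≤ q := by omega
        have h172 : q ≤ 172 := by omega
        interval_cases q
        all_goals first | exact h167 rfl | exact absurd hp (by norm_num)
      exact not_weilPositivityOnChar_log10half_principal_of_prime_le hp h163 (h 1)
  · intro h173 χ
    by_cases h179 : 179 ≤ q
    · exact forall_weilPositivityOnChar_log10half_of_prime_ge_179 h179 χ
    · have hq : q = 173 := by
        have h178 : q ≤ 178 := by omega
        interval_cases q
        all_goals first | rfl | exact absurd hp (by norm_num)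
      subst hq
      exact forall_weilPositivityOnChar_log10half_mod_oneSeventyThree χ

end UniformFloor

end Summit.Ventures.WeilGRH

end
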